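import Literature.Probability.LatticeModels.Sharpness
import Literature.Probability.LatticeModels.CriticalTwoPointBounds
import Literature.Probability.LatticeModels.PlusFreeComparison
import HarnessLib

/-!
# The critical state is well defined: discharge of `criticalCorr_wellDefined` (crit-ising.S09)

Topic `Probability/LatticeModels`. Theorem-only leaf file (no definitions, no named facts) proving
the named fact `Literature.Probability.LatticeModels.criticalCorr_wellDefined` of `Sharpness.lean`:
for the nearest-neighbour Ising model on `ℤ^d`, `d ≥ 3`, every `n`, every `x : Fin n → ℤ^d` and
each of the free, plus and minus boundary conditions, the finite-volume expectations
`⟨∏ᵢ σ_{xᵢ}⟩^{bc}_{B(L);β_c,0}` converge as `L → ∞` to the critical correlator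
`criticalCorr d n x = ⟨∏ᵢ σ_{xᵢ}⟩⁺_{β_c,0}`.

## The printed argument and its tree ingredients

Friedli–Velenik, *Statistical Mechanics of Lattice Systems* (CUP 2017): the plus and minus states
exist along any sequence `Λ_n ↑ ℤ^d` (Thm. 3.17, p. 106); at `h = 0`, uniqueness of the Gibbs state
is equivalent to `m*(β) = 0` (Thm. 3.28 with Remark 3.30, p. 117–120: `⟨σ₀⟩⁻_{β,0} = -⟨σ₀⟩⁺_{β,0}` by
symmetry, and `3 ⇒ 2` of Thm. 3.28 via the nondecreasing functions `∑_{i∈A} n_i − n_A` and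
Lemma 3.19); and uniqueness forces every boundary condition to have the same limit (Lemma 3.23).
The deep input is the continuity of the magnetisation at `β_c` in `d ≥ 3`,
`m*(β_c) = 0` (Aizenman–Duminil-Copin–Sidoravicius, CMP 334 (2015), Thm. 1.2 / Cor. 1.5), which is
the tree theorem `spontaneousMagnetization_criticalBeta_eq_zero_holds` (`CriticalTwoPointBounds.lean`).

Every other step is already a theorem of the tree and is only assembled here:

* existence of the plus and free states on spin products along boxes
  (`hasBoxLimit_isingCorr_plus_holds`, `hasBoxLimit_isingCorr_free_holds`, `GKSInequalities.lean`);
* the Lebowitz–Martin-Löf criterion in Friedli–Velenik's form, `m*(β) = 0 ⇒ ⟨σ_A⟩^∅_{β,0} = ⟨σ_A⟩⁺_{β,0}`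
  (`freeCorr_eq_plusCorr_of_spontaneousMagnetization_eq_zero`, `PlusFreeComparison.lean`, proved
  there exactly by the `∑ n_i − n_A` argument of Thm. 3.28);
* spin-flip symmetry `⟨σ_A⟩⁻_{Λ;β,0} = (-1)^{|A|} ⟨σ_A⟩⁺_{Λ;β,0}` (`isingCorr_fixed_flip_holds`,
  `IsingModel.lean`) and evenness of the free measure, `⟨σ_A⟩^∅_{Λ;β,0} = 0` for odd `|A|`
  (`isingCorr_free_zero_of_odd`, Friedli–Velenik eq. (3.33)).

New here (elementary): a spin monomial `∏ᵢ σ_{xᵢ}` is the spin product `σ_A` of the set `A` of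
sites of odd multiplicity (`σ_x² = 1`); odd free and (when `m* = 0`) odd plus correlations vanish in
infinite volume; hence the minus sequence `(-1)^{|A|}⟨σ_A⟩⁺_{B(L)}` has the plus limit too.

## References

* S. Friedli, Y. Velenik, *Statistical Mechanics of Lattice Systems* (CUP 2017), Thm. 3.17,
  Lemma 3.23, Thm. 3.28, Remark 3.30, eq. (3.33).
* M. Aizenman, H. Duminil-Copin, V. Sidoravicius, *Random currents and continuity of Ising model's
  spontaneous magnetization*, Comm. Math. Phys. 334 (2015) 719–742, Thm. 1.2, Cor. 1.5.
* J. L. Lebowitz, A. Martin-Löf, Comm. Math. Phys. 25 (1972) 276–282.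
-/

noncomputable section

open MeasureTheory Filter Topology Finset Literature.Probability.LatticeModels

namespace Literature.Probability.LatticeModels

/-! ### Spin monomials are spin products -/

section Monomial

variable {V : Type*}

/-- A power of a spin: `σ_v^k = 1` for even `k` and `= σ_v` for odd `k` (`σ_v² = 1`;
Friedli–Velenik 2017, §3.6.1). Local copy of `spinAt_pow_eq_ite` of
`HighDimTrivialityMoments.lean` (not imported: that module sits on the high-dimensional
triviality stack, foreign to this file). [folklore] -/
private theorem spinAt_pow_parity (v : V) (s : SpinConfig V) (k : ℕ) :
    spinAt v s ^ k = if Odd k then spinAt v s else 1 := by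
  rcases Nat.even_or_odd k with hk | hk
  · rw [if_neg (Nat.not_odd_iff_even.mpr hk)]
    rcases spinAt_eq_one_or_eq_neg_one v s with h1 | h1
    · rw [h1, one_pow]
    · rw [h1, hk.neg_one_pow]
  · rw [if_pos hk]
    rcases spinAt_eq_one_or_eq_neg_one v s with h1 | h1
    · rw [h1, one_pow]
    · rw [h1, hk.neg_one_pow]

/-- **A spin monomial is a spin product**: `∏ᵢ σ_{xᵢ} = σ_A` with `A` the set of sites occurring an
odd number of times in `x` (since `σ_v² = 1`; Friedli–Velenik 2017, §3.6.1, "`σ_A σ_B = σ_{A Δ B}`").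
Stated as an existence so that no auxiliary definition is introduced. [folklore] -/
theorem exists_spinMonomial_eq_spinProduct [DecidableEq V] {n : ℕ} (x : Fin n → V) :
    ∃ A : Finset V, spinMonomial x = spinProduct A := by
  refine ⟨(univ.image x).filter fun v => Odd #(univ.filter fun i => x i = v), funext fun s => ?_⟩
  unfold spinMonomial spinProduct
  rw [Finset.prod_comp (fun v => spinAt v s) x, Finset.prod_filter]
  refine Finset.prod_congr rfl fun v _ => ?_
  exact spinAt_pow_parity v s _

end Monomial

/-! ### Odd correlations of the free and (when `m* = 0`) plus states vanish -/

section Zd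

variable {d : ℕ}

/-- **The free state is even**: `⟨σ_A⟩^∅_{β,0} = 0` for `|A|` odd and `β ≥ 0` (box limit of the
vanishing odd finite-volume free correlations, Friedli–Velenik 2017, §3.7.1, eq. (3.33)). [cite: FriedliVelenik2017, §3.7.1, eq. (3.33)] -/
theorem freeCorr_eq_zero_of_odd_card {β : ℝ} (hβ : 0 ≤ β) {A : Finset (Site d)} (hA : Odd #A) :
    freeCorr d β 0 A = 0 := by
  have hlim := hasBoxLimit_isingCorr_free_holds (d := d) hβ le_rfl A
  obtain ⟨L₀, hL₀⟩ := exists_forall_subset_box d A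
  have hev : ∀ᶠ L : ℕ in atTop, isingCorr (zdGraph d) (box d L) β 0 .free A = 0 := by
    filter_upwards [eventually_ge_atTop L₀] with L hL
    exact isingCorr_free_zero_of_odd (zdGraph d) (box d L) β (hL₀ L hL) hA
  have h0 : Tendsto (fun L : ℕ => isingCorr (zdGraph d) (box d L) β 0 .free A) atTop (𝓝 0) :=
    tendsto_const_nhds.congr' (hev.mono fun L hL => hL.symm)
  exact tendsto_nhds_unique hlim h0

/-- **Odd plus correlations vanish when `m*(β) = 0`**: for `β ≥ 0` with `m*(β) = 0` and `|A|` odd,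
`⟨σ_A⟩⁺_{β,0} = 0` (Friedli–Velenik 2017, Thm. 3.28 with Remark 3.30: `m* = 0` gives uniqueness at
`h = 0`, so `⟨σ_A⟩⁺ = ⟨σ_A⟩^∅`, which is even by eq. (3.33); the equality `⟨σ_A⟩^∅ = ⟨σ_A⟩⁺` is the
tree theorem `freeCorr_eq_plusCorr_of_spontaneousMagnetization_eq_zero`). [cite: FriedliVelenik2017, Thm. 3.28 and Remark 3.30] -/
theorem plusCorr_eq_zero_of_odd_card {β : ℝ} (hβ : 0 ≤ β) (hm : spontaneousMagnetization d β = 0)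
    {A : Finset (Site d)} (hA : Odd #A) : plusCorr d β 0 A = 0 := by
  rw [← freeCorr_eq_plusCorr_of_spontaneousMagnetization_eq_zero hβ hm A]
  exact freeCorr_eq_zero_of_odd_card hβ hA

/-- **Spin flip between the minus and plus finite-volume correlations at zero field**:
`⟨σ_A⟩⁻_{Λ;β,0} = (-1)^{|A|} ⟨σ_A⟩⁺_{Λ;β,0}` (Friedli–Velenik 2017, §3.7.1; the tree theorem
`isingCorr_fixed_flip_holds` at `h = 0`, `η ≡ +1`). [cite: FriedliVelenik2017, §3.7.1] -/
theorem isingCorr_minus_eq_neg_one_pow_mul_plus (Λ : Finset (Site d)) (β : ℝ) (A : Finset (Site d)) :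
    isingCorr (zdGraph d) Λ β 0 .minus A = (-1) ^ #A * isingCorr (zdGraph d) Λ β 0 .plus A := by
  have h := isingCorr_fixed_flip_holds (zdGraph d) Λ β 0 1 A
  rw [neg_zero] at h
  exact h

/-- **Uniqueness at `m*(β) = 0` in the form needed for the correlators** (Friedli–Velenik 2017,
Thm. 3.28 with Remark 3.30 and Lemma 3.23; Lebowitz–Martin-Löf 1972): for `β ≥ 0` with
`m*(β) = 0`, every finite `A ⊂ ℤ^d` and each of the free, plus and minus boundary conditions, the
box sequence `⟨σ_A⟩^{bc}_{B(L);β,0}` converges to `⟨σ_A⟩⁺_{β,0}`. Plus: Thm. 3.17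
(`hasBoxLimit_isingCorr_plus_holds`); free: its GKS limit `⟨σ_A⟩^∅_{β,0}` equals `⟨σ_A⟩⁺_{β,0}`
(`freeCorr_eq_plusCorr_of_spontaneousMagnetization_eq_zero`); minus: `(-1)^{|A|}⟨σ_A⟩⁺_{B(L)}` by the
spin flip, and `⟨σ_A⟩⁺_{β,0} = 0` for odd `|A|`. [cite: FriedliVelenik2017, Thm. 3.28 and Remark 3.30] -/
theorem hasBoxLimit_isingCorr_of_spontaneousMagnetization_eq_zero {β : ℝ} (hβ : 0 ≤ β)
    (hm : spontaneousMagnetization d β = 0) (A : Finset (Site d)) :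
    ∀ bc ∈ ({.free, .plus, .minus} : Set (BoundaryCondition (Site d))),
      HasBoxLimit (fun Λ => isingCorr (zdGraph d) Λ β 0 bc A) (plusCorr d β 0 A) := by
  intro bc hbc
  simp only [Set.mem_insert_iff, Set.mem_singleton_iff] at hbc
  rcases hbc with rfl | rfl | rfl
  · have h := hasBoxLimit_isingCorr_free_holds (d := d) hβ le_rfl A
    rwa [freeCorr_eq_plusCorr_of_spontaneousMagnetization_eq_zero hβ hm A] at h
  · exact hasBoxLimit_isingCorr_plus_holds hβ le_rfl A
  · have hplus := hasBoxLimit_isingCorr_plus_holds (d := d) hβ le_rfl A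
    unfold HasBoxLimit at hplus ⊢
    simp_rw [isingCorr_minus_eq_neg_one_pow_mul_plus]
    rcases Nat.even_or_odd #A with hev | hodd
    · simpa only [hev.neg_one_pow, one_mul] using hplus
    · rw [plusCorr_eq_zero_of_odd_card hβ hm hodd] at hplus ⊢
      simpa only [mul_zero] using hplus.const_mul ((-1 : ℝ) ^ #A)

/-- **crit-ising.S09, proved: the critical state `⟨·⟩_{β_c}` is well defined** — discharge of the
named fact `criticalCorr_wellDefined` of `Sharpness.lean`: for `d ≥ 3`, every `n`, every
`x : Fin n → ℤ^d` and `bc ∈ {free, plus, minus}`,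
`⟨∏ᵢ σ_{xᵢ}⟩^{bc}_{B(L);β_c,0} → criticalCorr d n x = ⟨∏ᵢ σ_{xᵢ}⟩⁺_{β_c,0}` as `L → ∞`
(Friedli–Velenik 2017, Thm. 3.17, Lemma 3.23, Thm. 3.28 with Remark 3.30; the input `m*(β_c) = 0`
for `d ≥ 3` is Aizenman–Duminil-Copin–Sidoravicius 2015, Thm. 1.2 / Cor. 1.5, the tree theorem
`spontaneousMagnetization_criticalBeta_eq_zero_holds`). The monomial is rewritten as the spin
product of its odd-multiplicity sites and `hasBoxLimit_isingCorr_of_spontaneousMagnetization_eq_zero`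
applies at `β = β_c ≥ 0`. [cite: FriedliVelenik2017, Thm. 3.17, Lemma 3.23 and Thm. 3.28] [cite: AizenmanDuminilCopinSidoraviciusCMP2015, Thm. 1.2 with Cor. 1.5 (1)] -/
theorem criticalCorr_wellDefined_holds : criticalCorr_wellDefined (d := d) := by
  intro hd n x bc hbc
  classical
  obtain ⟨A, hA⟩ := exists_spinMonomial_eq_spinProduct x
  have hβ : 0 ≤ criticalBeta d := criticalBeta_nonneg d
  have hm : spontaneousMagnetization d (criticalBeta d) = 0 :=
    spontaneousMagnetization_criticalBeta_eq_zero_holds hd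
  have hcorr : criticalCorr d n x = plusCorr d (criticalBeta d) 0 A := by
    show plusExpect d (criticalBeta d) 0 (spinMonomial x) = _
    rw [hA]
    rfl
  rw [hcorr, hA]
  exact hasBoxLimit_isingCorr_of_spontaneousMagnetization_eq_zero hβ hm A bc hbc

end Zd

end Literature.Probability.LatticeModels
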